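import Summits.ValiantsHypothesis.ValiantsHypothesis.Theorems.LacunarySymmetroidMatrixDescartesNegSquaresRungs

/-!
# Negative-squares rungs at `m ≤ 2` — Theorems-side port 2/2: SEMIDEFINITE WORDS (`Z₊ ≤ 2|I||J|`) and the DoorA26 semidefinite sector (`≤ 18`)

PORT (val-port-4 g1, val-lit merged desk g11 RULING #259 (a)) of val-idea-6 g5's TURNKEY `Cruxes/MatrixDescartes/Lines/
negsquares_rungs_turnkey.lean` (sha16 d18263607a42fde7; val-idea-crit-1 #41 (A) / #43 «CLEAN FOR PORT»), turnkey l.291–443 VERBATIM over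
`…NegSquaresRungs` (port 1/2: `negCoeffCount`, doubled Descartes, `two_mul_le_of_psd2`, `coeff_sum_eq_zero`, …): `coeff_sum_mul_sum₂`, `entry_eq₂`,
`psd2_data`, `coeff_nonneg_off₂`, **`semidefinite_pair_two_le`** (PSD letters on support `I` against NSD letters on support `J`, any exponents ⇒
`Z₊ ≤ 2·|I|·|J|`) and **`door26_semidefinite_sector`** (six semidefinite `2×2` letters ⇒ `Z₊ ≤ 18 ≤ 19` = the `DoorA26` bound of
stmt-ValiantsHypothesis-19979 on that sector, same pencil expression as `PosRootLawAt 2 6 ·`).  Two one-line docstrings added (gate lint).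
`--supports stmt-ValiantsHypothesis-18050 --as helper`.  HONEST FRAME (turnkey's): sector theorems at `m ≤ 2`; `MatrixDescartes`
(stmt-18050), `DoorA26` in general, Conjecture B and VP ≠ VNP untouched and NOT proved.
-/

open Polynomial Finset

-- `Summit.ValiantsHypothesis.ValiantsHypothesis.…` repeats a component by the D-0017 layout
-- (single-conjunct summit), which the `dupNamespace` linter flags; the name is mandated.
set_option linter.dupNamespace false

namespace Summit.ValiantsHypothesis.ValiantsHypothesis.Theorems.LacunarySymmetroidMatrixDescartes.NegSquaresRungs

/-- Coefficients of a product of two lacunary sums `(Σ x_l X^{d l})(Σ y_l X^{e l})`. [folklore] -/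
theorem coeff_sum_mul_sum₂ {K : ℕ} (d e : Fin K → ℕ) (x y : Fin K → ℝ) (n : ℕ) :
    ((∑ l, C (x l) * (X : ℝ[X]) ^ d l) * (∑ l, C (y l) * (X : ℝ[X]) ^ e l)).coeff n
      = ∑ l, ∑ l', (if n = d l + e l' then x l * y l' else 0) := by
  rw [Finset.sum_mul_sum, finsetSum_coeff]
  refine Finset.sum_congr rfl (fun l _ => ?_)
  rw [finsetSum_coeff]
  refine Finset.sum_congr rfl (fun l' _ => ?_)
  have : C (x l) * (X : ℝ[X]) ^ d l * (C (y l') * X ^ e l') = C (x l * y l') * X ^ (d l + e l') := by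
    rw [C_mul, pow_add]; ring
  rw [this, coeff_C_mul_X_pow]

/-- entries of a PSD-minus-PSD two-family pencil at `m = 2` -/
theorem entry_eq₂ {K : ℕ} (d e : Fin K → ℕ) (P N : Fin K → Matrix (Fin 2) (Fin 2) ℝ) (i j : Fin 2) :
    ((∑ l, (X : ℝ[X]) ^ d l • (P l).map C) - ∑ l, (X : ℝ[X]) ^ e l • (N l).map C) i j
      = (∑ l, C (P l i j) * X ^ d l) - ∑ l, C (N l i j) * X ^ e l := by
  simp only [Matrix.sub_apply, Matrix.smul_apply, Matrix.map_apply, Matrix.sum_apply, smul_eq_mul]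
  congr 1 <;> exact Finset.sum_congr rfl (fun l _ => by ring)

/-- PSD data of a `2×2` real PSD matrix. -/
theorem psd2_data (M : Matrix (Fin 2) (Fin 2) ℝ) (hM : M.PosSemidef) :
    M 1 0 = M 0 1 ∧ 0 ≤ M 0 0 ∧ 0 ≤ M 1 1 ∧ M 0 1 ^ 2 ≤ M 0 0 * M 1 1 := by
  have hsym : M 1 0 = M 0 1 := by simpa using hM.isHermitian.apply 0 1
  refine ⟨hsym, hM.diag_nonneg, hM.diag_nonneg, ?_⟩
  have h := hM.det_nonneg
  rw [Matrix.det_fin_two, hsym] at h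
  nlinarith [h]

/-- **Semidefinite two-family pencils at `m = 2`.**  PSD letters `P l` at exponents `d l` and NSD letters
`−N l` at exponents `e l`, with `P` supported on `I` and `N` on `J`: every coefficient of `det` off the
sumset `d(I) + e(J)` is nonnegative. -/
theorem coeff_nonneg_off₂ {K : ℕ} (d e : Fin K → ℕ) (P N : Fin K → Matrix (Fin 2) (Fin 2) ℝ)
    (hP : ∀ l, (P l).PosSemidef) (hN : ∀ l, (N l).PosSemidef) (I J : Finset (Fin K))
    (hI : ∀ l, l ∉ I → P l = 0) (hJ : ∀ l, l ∉ J → N l = 0) (n : ℕ)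
    (hn : n ∉ Finset.image₂ (fun l l' => d l + e l') I J) :
    0 ≤ (Matrix.det ((∑ l, (X : ℝ[X]) ^ d l • (P l).map C)
          - ∑ l, (X : ℝ[X]) ^ e l • (N l).map C)).coeff n := by
  set AP : ℝ[X] := ∑ l, C (P l 0 0) * X ^ d l with hAP
  set BP : ℝ[X] := ∑ l, C (P l 0 1) * X ^ d l with hBP
  set CP : ℝ[X] := ∑ l, C (P l 1 1) * X ^ d l with hCP
  set AN : ℝ[X] := ∑ l, C (N l 0 0) * X ^ e l with hAN
  set BN : ℝ[X] := ∑ l, C (N l 0 1) * X ^ e l with hBN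
  set CN : ℝ[X] := ∑ l, C (N l 1 1) * X ^ e l with hCN
  have hsP : ∀ l, P l 1 0 = P l 0 1 := fun l => (psd2_data _ (hP l)).1
  have hsN : ∀ l, N l 1 0 = N l 0 1 := fun l => (psd2_data _ (hN l)).1
  have hBP' : ∑ l, C (P l 1 0) * (X : ℝ[X]) ^ d l = BP := by simp only [hBP, hsP]
  have hBN' : ∑ l, C (N l 1 0) * (X : ℝ[X]) ^ e l = BN := by simp only [hBN, hsN]
  have hdet : Matrix.det ((∑ l, (X : ℝ[X]) ^ d l • (P l).map C) - ∑ l, (X : ℝ[X]) ^ e l • (N l).map C)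
      = (AP * CP - BP * BP) + (AN * CN - BN * BN) - (AP * CN + CP * AN - 2 * (BP * BN)) := by
    rw [Matrix.det_fin_two, entry_eq₂, entry_eq₂, entry_eq₂, entry_eq₂, hBP', hBN',
      ← hAP, ← hBP, ← hCP, ← hAN, ← hCN]
    ring
  rw [hdet, coeff_sub, coeff_add]
  -- the two pure parts are coefficient-nonnegative
  have h1 : 0 ≤ (AP * CP - BP * BP).coeff n := by
    rw [coeff_sub, hAP, hBP, hCP, coeff_sum_mul_sum₂, coeff_sum_mul_sum₂]
    exact double_sum_nonneg d _ _ _ (fun l => (psd2_data _ (hP l)).2.1)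
      (fun l => (psd2_data _ (hP l)).2.2.1) (fun l => (psd2_data _ (hP l)).2.2.2) n
  have h2 : 0 ≤ (AN * CN - BN * BN).coeff n := by
    rw [coeff_sub, hAN, hBN, hCN, coeff_sum_mul_sum₂, coeff_sum_mul_sum₂]
    exact double_sum_nonneg e _ _ _ (fun l => (psd2_data _ (hN l)).2.1)
      (fun l => (psd2_data _ (hN l)).2.2.1) (fun l => (psd2_data _ (hN l)).2.2.2) n
  -- the mixed part lives on the sumset d(I) + e(J)
  have hmix : ∀ (x y : Fin K → ℝ), (∀ l, l ∉ I → x l = 0) → (∀ l, l ∉ J → y l = 0) →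
      ((∑ l, C (x l) * (X : ℝ[X]) ^ d l) * (∑ l, C (y l) * (X : ℝ[X]) ^ e l)).coeff n = 0 := by
    intro x y hx hy
    rw [coeff_sum_mul_sum₂]
    refine Finset.sum_eq_zero (fun l _ => Finset.sum_eq_zero (fun l' _ => ?_))
    by_cases hl : l ∈ I
    · by_cases hl' : l' ∈ J
      · have : n ≠ d l + e l' := fun h => hn (Finset.mem_image₂.mpr ⟨l, hl, l', hl', h.symm⟩)
        rw [if_neg this]
      · rw [hy l' hl']; simp
    · rw [hx l hl]; simp
  have h3 : (AP * CN + CP * AN - 2 * (BP * BN)).coeff n = 0 := by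
    have e1 : (AP * CN).coeff n = 0 := by
      rw [hAP, hCN]
      exact hmix (fun l => P l 0 0) (fun l => N l 1 1) (fun l hl => by simp [hI l hl])
        (fun l hl => by simp [hJ l hl])
    have e2 : (CP * AN).coeff n = 0 := by
      rw [hCP, hAN]
      exact hmix (fun l => P l 1 1) (fun l => N l 0 0) (fun l hl => by simp [hI l hl])
        (fun l hl => by simp [hJ l hl])
    have e3 : (BP * BN).coeff n = 0 := by
      rw [hBP, hBN]
      exact hmix (fun l => P l 0 1) (fun l => N l 0 1) (fun l hl => by simp [hI l hl])
        (fun l hl => by simp [hJ l hl])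
    rw [coeff_sub, coeff_add, e1, e2, two_mul, coeff_add, e3]
    simp
  linarith [h1, h2, h3]

/-- **`m = 2`, semidefinite words (PROVED):** PSD letters `P` supported on `I` against NSD letters `−N` supported on `J`, any exponents `d`, `e` ⇒ the determinant has at most `2·|I|·|J|` distinct positive zeros. -/
theorem semidefinite_pair_two_le {K : ℕ} (d e : Fin K → ℕ) (P N : Fin K → Matrix (Fin 2) (Fin 2) ℝ)
    (hP : ∀ l, (P l).PosSemidef) (hN : ∀ l, (N l).PosSemidef) (I J : Finset (Fin K))
    (hI : ∀ l, l ∉ I → P l = 0) (hJ : ∀ l, l ∉ J → N l = 0) :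
    ((Matrix.det ((∑ l, (X : ℝ[X]) ^ d l • (P l).map C)
          - ∑ l, (X : ℝ[X]) ^ e l • (N l).map C)).roots.toFinset.filter (fun t => 0 < t)).card
      ≤ 2 * (I.card * J.card) := by
  set f := Matrix.det ((∑ l, (X : ℝ[X]) ^ d l • (P l).map C)
          - ∑ l, (X : ℝ[X]) ^ e l • (N l).map C) with hf
  refine (card_posRoots_le_two_mul_negCoeffCount f).trans (Nat.mul_le_mul_left 2 ?_)
  have hsub : f.support.filter (fun n => f.coeff n < 0)
      ⊆ Finset.image₂ (fun l l' => d l + e l') I J := by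
    intro n hn
    rw [Finset.mem_filter] at hn
    by_contra hno
    exact absurd (coeff_nonneg_off₂ d e P N hP hN I J hI hJ n hno) (not_le.mpr hn.2)
  exact (Finset.card_le_card hsub).trans (Finset.card_image₂_le _ _ _)

/-- **The semidefinite-word sector of the `(2,6)` door is closed: `Z₊ ≤ 18 ≤ 19`** (stmt-ValiantsHypothesis-19979
`DoorA26 = PosRootLawAt 2 6 19`, same pencil expression).  Six `2×2` letters each PSD or NSD, ANY exponents
(repeats allowed), any heights, any interleaving of the sign word: `Z₊ ≤ 2·K_P·K_N ≤ 18`.  This is the class of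
line `sign_split` (semidefinite words, V-currency) at `m = 2`, V-free; by the octave cell's definiteness census
(`Cruxes/WeakLifting/Lines/octave.md` (e)) no record pencil of the eleven-thirds register lies in it — every
`DoorA26` violator has an INDEFINITE letter (and, by `door26_rankOne_sector`, at least two negative squares). -/
theorem door26_semidefinite_sector (d : Fin 6 → ℕ) (S : Fin 6 → Matrix (Fin 2) (Fin 2) ℝ)
    (hS : ∀ l, (S l).PosSemidef ∨ (-S l).PosSemidef) :
    ((Matrix.det (∑ l, (X : ℝ[X]) ^ d l • (S l).map C)).roots.toFinset.filter
      (fun t => 0 < t)).card ≤ 18 := by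
  classical
  set I : Finset (Fin 6) := Finset.univ.filter (fun l => (S l).PosSemidef) with hIdef
  set J : Finset (Fin 6) := Finset.univ.filter (fun l => ¬ (S l).PosSemidef) with hJdef
  set P : Fin 6 → Matrix (Fin 2) (Fin 2) ℝ := fun l => if (S l).PosSemidef then S l else 0 with hPdef
  set N : Fin 6 → Matrix (Fin 2) (Fin 2) ℝ := fun l => if (S l).PosSemidef then 0 else -S l with hNdef
  have hP : ∀ l, (P l).PosSemidef := fun l => by
    simp only [hPdef]; split_ifs with h
    · exact h
    · exact Matrix.PosSemidef.zero
  have hN : ∀ l, (N l).PosSemidef := fun l => by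
    simp only [hNdef]; split_ifs with h
    · exact Matrix.PosSemidef.zero
    · exact (hS l).resolve_left h
  have hI : ∀ l, l ∉ I → P l = 0 := fun l hl => by
    have : ¬ (S l).PosSemidef := fun h => hl (by simp [hIdef, h])
    simp [hPdef, this]
  have hJ : ∀ l, l ∉ J → N l = 0 := fun l hl => by
    have : (S l).PosSemidef := by
      by_contra h; exact hl (by simp [hJdef, h])
    simp [hNdef, this]
  have hsplit : (∑ l, (X : ℝ[X]) ^ d l • (S l).map C)
      = (∑ l, (X : ℝ[X]) ^ d l • (P l).map C) - ∑ l, (X : ℝ[X]) ^ d l • (N l).map C := by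
    rw [← Finset.sum_sub_distrib]
    refine Finset.sum_congr rfl (fun l _ => ?_)
    have hSl : S l = P l - N l := by
      simp only [hPdef, hNdef]; split_ifs <;> simp
    rw [hSl, Matrix.map_sub _ (fun a b => (map_sub C a b)), smul_sub]
  rw [hsplit]
  refine (semidefinite_pair_two_le d d P N hP hN I J hI hJ).trans ?_
  have hcard : I.card + J.card = 6 := by
    rw [hIdef, hJdef, Finset.card_filter_add_card_filter_not]; simp
  generalize I.card = a at hcard ⊢
  generalize J.card = b at hcard ⊢
  have ha : a ≤ 6 := by omega
  interval_cases a <;> omega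

end Summit.ValiantsHypothesis.ValiantsHypothesis.Theorems.LacunarySymmetroidMatrixDescartes.NegSquaresRungs
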